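import Mathlib

/-!
# The target maximal minor of `[1 | Z]` is `+det X`

For `n ≤ m'` the target column block `T = {x : Fin (n + m') | n ≤ x < 2n}` has `n` elements,
its sorted enumeration (`Finset.orderEmbOfFin`) is `j ↦ Fin.natAdd n (Fin.castLE h j)`
(`Finset.orderEmbOfFin_unique`), and on that column tuple the matrix
`[1 | Z] = (Matrix.fromCols 1 Z).submatrix id finSumFinEquiv.symm` (with `Z` the generic `n × m'`
matrix of variables) is literally `Matrix.of fun i j => X (i, Fin.castLE h j)`, so the target
maximal minor is the determinant of that matrix with sign `+1`. [folklore]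
-/

set_option linter.dupNamespace false

namespace Summit.MatrixMultiplication.MatrixMultiplication.Theorems.CondensationSound

/-- The map `j ↦ natAdd n (castLE h j)` (value `n + j`) takes values in the target block
`{x | n ≤ x < 2n}` of `Fin (n + m')`. [folklore] -/
theorem natAdd_castLE_mem_targetCols {n m' : ℕ} (h : n ≤ m') (j : Fin n) :
    Fin.natAdd n (Fin.castLE h j) ∈
      (Finset.univ.filter fun x : Fin (n + m') => n ≤ x.val ∧ x.val < 2 * n) := by
  simp only [Finset.mem_filter, Finset.mem_univ, true_and, Fin.val_natAdd, Fin.val_castLE]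
  omega

/-- The map `j ↦ natAdd n (castLE h j)` (value `n + j`) is strictly monotone. [folklore] -/
theorem strictMono_natAdd_castLE_targetCols {n m' : ℕ} (h : n ≤ m') :
    StrictMono (fun j : Fin n => Fin.natAdd n (Fin.castLE h j) : Fin n → Fin (n + m')) := by
  intro a b hab
  rw [Fin.lt_def] at hab ⊢
  simp only [Fin.val_natAdd, Fin.val_castLE]
  omega

/-- The target block `{x | n ≤ x < 2n}` of `Fin (n + m')` is the image of
`j ↦ natAdd n (castLE h j)` when `n ≤ m'`. [folklore] -/
theorem targetCols_eq_image_natAdd_castLE {n m' : ℕ} (h : n ≤ m') :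
    (Finset.univ.filter fun x : Fin (n + m') => n ≤ x.val ∧ x.val < 2 * n) =
      Finset.univ.image (fun j : Fin n => Fin.natAdd n (Fin.castLE h j)) := by
  ext x
  simp only [Finset.mem_filter, Finset.mem_univ, true_and, Finset.mem_image]
  constructor
  · rintro ⟨h1, h2⟩
    refine ⟨⟨x.val - n, by omega⟩, ?_⟩
    ext
    simp only [Fin.val_natAdd, Fin.val_castLE]
    omega
  · rintro ⟨j, rfl⟩
    simp only [Fin.val_natAdd, Fin.val_castLE]
    omega

/-- The target block `{x | n ≤ x < 2n}` of `Fin (n + m')` has `n` elements when `n ≤ m'`.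
[folklore] -/
theorem targetCols_card {n m' : ℕ} (h : n ≤ m') :
    (Finset.univ.filter fun x : Fin (n + m') => n ≤ x.val ∧ x.val < 2 * n).card = n := by
  rw [targetCols_eq_image_natAdd_castLE h,
    Finset.card_image_of_injective _ (strictMono_natAdd_castLE_targetCols h).injective,
    Finset.card_univ, Fintype.card_fin]

/-- The sorted enumeration of the target block `{x | n ≤ x < 2n}` is `j ↦ natAdd n (castLE h j)`
(`Finset.orderEmbOfFin_unique`). [folklore] -/
theorem orderEmbOfFin_targetCols {n m' : ℕ} (h : n ≤ m')
    (hc : (Finset.univ.filter fun x : Fin (n + m') => n ≤ x.val ∧ x.val < 2 * n).card = n) :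
    ⇑((Finset.univ.filter fun x : Fin (n + m') => n ≤ x.val ∧ x.val < 2 * n).orderEmbOfFin hc) =
      fun j : Fin n => Fin.natAdd n (Fin.castLE h j) :=
  (Finset.orderEmbOfFin_unique hc (natAdd_castLE_mem_targetCols h)
    (strictMono_natAdd_castLE_targetCols h)).symm

/-- On the column tuple `j ↦ natAdd n (castLE h j)` the matrix `[1 | Z]` is literally
`Matrix.of fun i j => X (i, castLE h j)` (`finSumFinEquiv_symm_apply_natAdd`,
`Matrix.fromCols_apply_inr`). [folklore] -/
theorem oneFromCols_submatrix_natAdd_castLE {n m' : ℕ} (h : n ≤ m') :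
    ((Matrix.fromCols (1 : Matrix (Fin n) (Fin n) (MvPolynomial (Fin n × Fin m') ℂ))
          (Matrix.of fun i j => MvPolynomial.X (i, j))).submatrix id ⇑finSumFinEquiv.symm).submatrix
        id (fun j : Fin n => Fin.natAdd n (Fin.castLE h j)) =
      Matrix.of fun i j : Fin n => MvPolynomial.X (i, Fin.castLE h j) := by
  ext i j
  simp [Matrix.submatrix_apply, finSumFinEquiv_symm_apply_natAdd, Matrix.fromCols_apply_inr]

/-- **The target value is `+det X`.**  For `n ≤ m'` the target set `T = {x : n ≤ x < 2n}` has `n`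
elements, its sorted enumeration (`Finset.orderEmbOfFin`) is `j ↦ natAdd n (castLE h j)`
(`Finset.orderEmbOfFin_unique`: the map is strictly monotone with values in `T`), and on that
tuple `[1 | Z]` is literally the matrix `of fun i j => X (i, castLE h j)`
(`finSumFinEquiv_symm_apply_natAdd`, `Matrix.fromCols_apply_inr`). [folklore] -/
theorem stub_target :
    ∀ (n m' : ℕ) (h : n ≤ m'),
      ∃ hc : (Finset.univ.filter fun x : Fin (n + m') => n ≤ x.val ∧ x.val < 2 * n).card = n,
        (((Matrix.fromCols (1 : Matrix (Fin n) (Fin n) (MvPolynomial (Fin n × Fin m') ℂ))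
          (Matrix.of fun i j => MvPolynomial.X (i, j))).submatrix id ⇑finSumFinEquiv.symm).submatrix
            id ⇑((Finset.univ.filter fun x : Fin (n + m') => n ≤ x.val ∧ x.val < 2 * n).orderEmbOfFin
              hc)).det =
          (Matrix.of fun i j : Fin n => MvPolynomial.X (i, Fin.castLE h j)).det := by
  intro n m' h
  refine ⟨targetCols_card h, ?_⟩
  rw [orderEmbOfFin_targetCols h (targetCols_card h), oneFromCols_submatrix_natAdd_castLE h]

end Summit.MatrixMultiplication.MatrixMultiplication.Theorems.CondensationSound
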